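import Literature.NumberTheory.EllipticCurves.CongruenceVisibility
import Literature.NumberTheory.EllipticCurves.MordellWeilTheoremProofs
import Literature.NumberTheory.GaloisRepresentations.LocalOneUnitsNumberFieldProofs
import HarnessLib

/-!
# Visible elements of `Ш(E/K)[p]` from a `p`-congruent curve, II: the local factors and the rank form

`Proofs`-style file (theorems only: no definition, no named fact) in topic
`NumberTheory/EllipticCurves`, companion of `CongruenceVisibility.lean` (the dimension count of
Cremona–Mazur / Agashe–Stein for a `Γ_K`-isomorphism `θ : E'[p] ≅ E[p]`, valid also at `p ∣ N`).
Written for the cell `b2b-bsdres` (run/shared/lean/b2b/bsd-rank1-residual/), whose HONEST FRAMING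
applies to its use there: the goal of that cell is to DELETE the COMBINATION-SHAPED residual classes
for ALL analytic-rank `≤ 1` elliptic curves over `ℚ` — "full BSD formula for every rank `≤ 1` curve
in class C" assembled STRICTLY from published theorems — so that the rank-`≤ 1` remainder becomes
exactly the CONSTRUCTION-SHAPED classes, which are TYPED (missing-input `Prop`s), NOT attempted;
this is not "finishing BSD".

This file turns the counting hypothesis `[E(K):pE(K)] · ∏_{v ∈ S} #𝓛_v(E') < [E'(K):pE'(K)]` of
`WeierstrassCurve.exists_sha_ne_zero_of_congr_of_index_lt` into quantities a per-curve
computation certifies: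
* `natCard_quot_adicCompletionIntegers_eq_one` (`#(𝓞_v/p) = 1` for `v ∤ p`) and
  `prod_natCard_quot_adicCompletionIntegers` (`∏_{v ∈ S} #(𝓞_v/p) = p^{[K:ℚ]}` when `S ⊇ {v ∣ p}`;
  `∑_{v ∣ p} [K_v:ℚ_p] = [K:ℚ]`, Neukirch *ANT* II (8.4), tree `OneUnits.sum_eq_finrank`), so that with
  Milne *ADT* I Lemma 3.3 (`#𝓛_v = #E'(K_v)[p] · #(𝓞_v/p)`, tree
  `natCard_kummerLocalConditionAt_adicCompletion`) the product is
  `(∏_{v ∈ S} #E'(K_v)[p]) · p^{[K:ℚ]}` — `exists_sha_ne_zero_of_congr`;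
* `index_range_zsmul_eq_one_of_coprime` (`[A : pA] = 1` for a finite group of order prime to `p`),
  `natCard_point_eq_torsionOrder` (`#E(K) = #E(K)_{tors}` for finite `E(K)`)
  and `pow_mordellWeilRank_le_index_range_zsmul` (`p^{rank E(K)} ≤ [E(K):pE(K)]`, Mordell–Weil,
  Silverman *AEC* VIII.6.7, tree `module_finite_point_holds`);
* `exists_sha_ne_zero_of_congr_of_rank`: the shape met in practice — `E(K)` finite of order prime
  to `p`, `E'(K_v)[p] = 0` for `v ∈ S`, `rank E'(K) ≥ [K:ℚ] + 1` (over `ℚ`: a rank-`0` curve with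
  `p ∤ #E(ℚ)` and a `p`-congruent curve of rank `≥ 2` without `ℚ_v`-rational `p`-torsion at the bad
  primes and at `p`) ⇒ `Ш(E/K)[p] ≠ 0`. This is Cremona–Mazur's Table 1 situation, now with no
  condition on the reduction type at `p`.

## References

* [CremonaMazur2000] J. E. Cremona, B. Mazur, *Visualizing elements in the Shafarevich–Tate
  group*, Experiment. Math. 9 (2000) 13–28, §3 and Table 1.
* [AgasheStein2002] A. Agashe, W. Stein, *Visibility of Shafarevich–Tate groups of abelian
  varieties*, J. Number Theory 97 (2002) 171–185, Thm. 3.1.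
* [MilneADT2006] J. S. Milne, *Arithmetic Duality Theorems*, 2nd ed., I Lemma 3.3.
* [SilvermanAEC2009] J. H. Silverman, *The Arithmetic of Elliptic Curves*, 2nd ed., Thm. VIII.6.7.
* J. Neukirch, *Algebraic Number Theory* (1999), Ch. II (8.4).
-/

noncomputable section

open scoped Classical

namespace WeierstrassCurve

open Literature.NumberTheory.EllipticCurves Literature.NumberTheory.GaloisRepresentations Field
open NumberField IsDedekindDomain

section Main

variable {K : Type} [Field K] [NumberField K] (W W' : WeierstrassCurve K) [W.IsElliptic]
  [W'.IsElliptic] {p : ℕ} [Fact p.Prime]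

/-! ### The local factors: `#𝓛_v = #E'(K_v)[p] · #(𝓞_v / p)` and `∏_{v ∣ p} #(𝓞_v / p) = p^{[K:ℚ]}` -/

omit [W.IsElliptic] [W'.IsElliptic] [Fact p.Prime] in
/-- At a finite place `v ∤ p`, `#(𝓞_v / p 𝓞_v) = 1` (`p` is a `v`-adic unit). [folklore] -/
theorem natCard_quot_adicCompletionIntegers_eq_one {v : HeightOneSpectrum (𝓞 K)}
    (hv : (p : 𝓞 K) ∉ v.asIdeal) :
    Nat.card (v.adicCompletionIntegers K ⧸ Ideal.span {(p : v.adicCompletionIntegers K)}) = 1 := by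
  have hu : IsUnit (p : v.adicCompletionIntegers K) := by
    rw [LocalPoints.isUnit_iff_valuation_eq_one]
    have h := LocalPoints.valuation_natCast_eq_one v hv
    convert h using 2
    simp
  haveI : Subsingleton (v.adicCompletionIntegers K ⧸ Ideal.span {(p : v.adicCompletionIntegers K)}) :=
    Ideal.Quotient.subsingleton_iff.mpr (Ideal.span_singleton_eq_top.mpr hu)
  exact Nat.card_of_subsingleton 0

omit [W.IsElliptic] [W'.IsElliptic] in
/-- **`∏_{v ∈ S} #(𝓞_v / p 𝓞_v) = p^{[K : ℚ]}`** for any finite set `S` of finite places containing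
every place above `p` (`∑_{v ∣ p} [K_v : ℚ_p] = [K : ℚ]`; tree `OneUnits.sum_eq_finrank`; the factors
at `v ∤ p` are `1`). Neukirch, *ANT*, II (8.4). [folklore] -/
theorem prod_natCard_quot_adicCompletionIntegers (S : Finset (HeightOneSpectrum (𝓞 K)))
    (hS : ∀ v : HeightOneSpectrum (𝓞 K), v ∉ S → (p : 𝓞 K) ∉ v.asIdeal) :
    ∏ v ∈ S, Nat.card (v.adicCompletionIntegers K ⧸ Ideal.span {(p : v.adicCompletionIntegers K)}) =
      p ^ Module.finrank ℚ K := by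
  classical
  set T := S.filter (fun v ↦ (p : 𝓞 K) ∈ v.asIdeal) with hT
  have hTmem : ∀ w : HeightOneSpectrum (𝓞 K), (p : 𝓞 K) ∈ w.asIdeal → w ∈ T := fun w hw ↦ by
    rw [hT, Finset.mem_filter]
    exact ⟨by_contra fun h ↦ hS w h hw, hw⟩
  have hex : ∀ w : HeightOneSpectrum (𝓞 K), ∃ n : ℕ, (p : 𝓞 K) ∈ w.asIdeal →
      Nat.card (w.adicCompletionIntegers K ⧸ Ideal.span {(p : w.adicCompletionIntegers K)}) =
        p ^ n := by
    intro w
    by_cases hw : (p : 𝓞 K) ∈ w.asIdeal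
    · obtain ⟨n, N, φ, h, -⟩ :=
        OneUnits.exists_continuousMonoidHom_adicCompletionIntegers_rank K w p hw
      exact ⟨n, fun _ ↦ h⟩
    · exact ⟨0, fun h ↦ absurd h hw⟩
  choose n hn using hex
  have hnT : ∀ w ∈ T,
      Nat.card (w.adicCompletionIntegers K ⧸ Ideal.span {(p : w.adicCompletionIntegers K)}) =
        p ^ n w := fun w hw ↦ hn w (Finset.mem_filter.mp hw).2
  have hsum : ∑ w ∈ T, n w = Module.finrank ℚ K := OneUnits.sum_eq_finrank K p T hTmem n hnT
  rw [← Finset.prod_filter_mul_prod_filter_not S (fun v ↦ (p : 𝓞 K) ∈ v.asIdeal), ← hT,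
    Finset.prod_eq_one (s := S.filter fun v ↦ ¬ (p : 𝓞 K) ∈ v.asIdeal)
      (fun v hv ↦ natCard_quot_adicCompletionIntegers_eq_one (Finset.mem_filter.mp hv).2),
    mul_one, Finset.prod_congr rfl hnT, Finset.prod_pow_eq_pow_sum, hsum]

/-- **The dimension count with the local factors made explicit.** Same as
`exists_sha_ne_zero_of_congr_of_index_lt`, the order of the local Kummer condition being
`#𝓛_v(E') = #E'(K_v)[p] · #(𝓞_v/p)` (Milne, *ADT*, I Lemma 3.3; tree
`natCard_kummerLocalConditionAt_adicCompletion`) and `∏_{v ∈ S} #(𝓞_v/p) = p^{[K:ℚ]}`: if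
`[E(K) : pE(K)] · (∏_{v ∈ S} #E'(K_v)[p]) · p^{[K:ℚ]} < [E'(K) : pE'(K)]` then `Ш(E/K)[p] ≠ 0`
(`E'(K_v)` = Mathlib's points of `W' ⊗ K_v`, `E'(K_v)[p]` = the kernel of multiplication by `p`).
[cite: CremonaMazur2000, §3 pp. 19–22] [cite: AgasheStein2002, Lemma 3.6 and Thm. 3.1]
[cite: MilneADT2006, I Lemma 3.3] -/
theorem exists_sha_ne_zero_of_congr (hp2 : p ≠ 2)
    (θ : geomTorsion W' (p : ℤ) ≃+ geomTorsion W (p : ℤ))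
    (hθ : ∀ (σ : absoluteGaloisGroup K) (P : geomTorsion W' (p : ℤ)), θ (σ • P) = σ • θ P)
    (S : Finset (HeightOneSpectrum (𝓞 K)))
    (hS : ∀ v : HeightOneSpectrum (𝓞 K), v ∉ S →
      W.HasGoodReductionAt v ∧ W'.HasGoodReductionAt v ∧ (p : 𝓞 K) ∉ v.asIdeal)
    (hlt : (zsmulAddGroupHom (p : ℤ) : W.toAffine.Point →+ W.toAffine.Point).range.index *
        (∏ v ∈ S, Nat.card (nsmulAddMonoidHom p :
          (W'.baseChange (v.adicCompletion K)).toAffine.Point →+ _).ker) * p ^ Module.finrank ℚ K <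
      (zsmulAddGroupHom (p : ℤ) : W'.toAffine.Point →+ W'.toAffine.Point).range.index) :
    ∃ c : W.sha, c ≠ 0 ∧ p • c = 0 := by
  have hp : p.Prime := Fact.out
  refine exists_sha_ne_zero_of_congr_of_index_lt W W' hp2 θ hθ S hS ?_
  have hprod : ∏ v ∈ S, Nat.card (W'.kummerLocalConditionAt (p : ℤ) (v.adicCompletion K)) =
      (∏ v ∈ S, Nat.card (nsmulAddMonoidHom p :
          (W'.baseChange (v.adicCompletion K)).toAffine.Point →+ _).ker) * p ^ Module.finrank ℚ K := by
    rw [← prod_natCard_quot_adicCompletionIntegers (p := p) S fun v hv ↦ (hS v hv).2.2,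
      ← Finset.prod_mul_distrib]
    exact Finset.prod_congr rfl fun v _ ↦ W'.natCard_kummerLocalConditionAt_adicCompletion v hp.ne_zero
  rw [hprod, ← mul_assoc]
  exact hlt

/-! ### Bounding the two indices: `[E(K) : pE(K)] = 1` for `p ∤ #E(K)`, `p^{rank} ≤ [E'(K) : pE'(K)]` -/

omit [NumberField K] [W.IsElliptic] [W'.IsElliptic] [Fact p.Prime] in
/-- In a finite abelian group of order prime to `p`, multiplication by `p` is onto:
`[A : pA] = 1`. [folklore] -/
theorem _root_.Literature.NumberTheory.EllipticCurves.index_range_zsmul_eq_one_of_coprime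
    {A : Type*} [AddCommGroup A] [Finite A] (hA : (Nat.card A).Coprime p) :
    (zsmulAddGroupHom (p : ℤ) : A →+ A).range.index = 1 := by
  rw [AddSubgroup.index_eq_one, AddMonoidHom.range_eq_top]
  have hinj : Function.Injective (zsmulAddGroupHom (p : ℤ) : A →+ A) := by
    rw [injective_iff_map_eq_zero]
    intro a ha
    rw [zsmulAddGroupHom_apply, natCast_zsmul] at ha
    have h1 : addOrderOf a ∣ p := addOrderOf_dvd_of_nsmul_eq_zero ha
    have h2 : addOrderOf a ∣ Nat.card A := addOrderOf_dvd_natCard a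
    have h3 : addOrderOf a ∣ Nat.gcd (Nat.card A) p := Nat.dvd_gcd h2 h1
    rw [hA, Nat.dvd_one] at h3
    exact AddMonoid.addOrderOf_eq_one_iff.mp h3
  exact Finite.surjective_of_injective hinj

omit [W'.IsElliptic] [Fact p.Prime] in
/-- **`n^{rank E(K)} ≤ [E(K) : nE(K)]`** (`n ≥ 1`): the quotient `E(K)/nE(K)` surjects onto
`F/nF ≅ (ℤ/n)^{rank}` for the free part `F = E(K)/E(K)_{tors}` (Mordell–Weil,
`module_finite_point_holds`; Silverman, *AEC*, VIII.§6), and `[E(K) : nE(K)]` is finite (the Kummer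
image injects into the finite Selmer group). [cite: SilvermanAEC2009, Thm. VIII.6.7] -/
theorem pow_mordellWeilRank_le_index_range_zsmul {n : ℕ} (hn : n ≠ 0) :
    n ^ W.mordellWeilRank ≤
      (zsmulAddGroupHom (n : ℤ) : W.toAffine.Point →+ W.toAffine.Point).range.index := by
  haveI : NeZero n := ⟨hn⟩
  have hn' : (n : ℤ) ≠ 0 := Int.natCast_ne_zero.mpr hn
  -- finiteness of the index, through the Kummer map into the finite Selmer group
  have hdiv : ∀ P : geomPoints W, ∃ Q : geomPoints W, (n : ℤ) • Q = P :=
    W.zsmul_geomPoints_surjective_holds hn'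
  haveI : Finite (W.selmerGroup (n : ℤ)) := W.finite_selmerGroup_holds hn'
  have hκle : (kummerMapTorsion W (n : ℤ) hdiv).range ≤ W.selmerGroup (n : ℤ) := by
    rintro _ ⟨P, rfl⟩
    exact (mem_selmerGroup_iff W _ _).mpr
      ⟨fun v ↦ kummerMapTorsion_mem_selmerLocalKer W _ hdiv _ P,
        fun w ↦ kummerMapTorsion_mem_selmerLocalKer W _ hdiv _ P⟩
  haveI : Finite (kummerMapTorsion W (n : ℤ) hdiv).range :=
    Finite.of_injective _ (AddSubgroup.inclusion_injective hκle)
  have hidx : (zsmulAddGroupHom (n : ℤ) : W.toAffine.Point →+ W.toAffine.Point).range.index ≠ 0 := by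
    rw [← kummerMapTorsion_ker W (n : ℤ) hdiv, AddSubgroup.index_ker]
    exact Nat.card_pos.ne'
  -- Mordell–Weil
  haveI : Module.Finite ℤ W.toAffine.Point := W.module_finite_point_holds
  haveI : Module.Free ℤ (mordellWeilModTorsion W) :=
    module_free_mordellWeilModTorsion W W.module_finite_point_holds
  haveI : Module.Finite ℤ (mordellWeilModTorsion W) :=
    Module.Finite.of_surjective
      ((QuotientAddGroup.mk' (AddCommGroup.torsion W.toAffine.Point)).toIntLinearMap)
      (QuotientAddGroup.mk'_surjective (AddCommGroup.torsion W.toAffine.Point))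
  have hrank : Module.finrank ℤ (mordellWeilModTorsion W) = W.mordellWeilRank :=
    finrank_mordellWeilModTorsion_eq_holds W
  set φ : W.toAffine.Point →+ ModN (mordellWeilModTorsion W) n :=
    (ModN.mkQ (G := mordellWeilModTorsion W) n).comp
      (QuotientAddGroup.mk' (AddCommGroup.torsion W.toAffine.Point)) with hφdef
  have hφ : Function.Surjective φ :=
    (Submodule.mkQ_surjective _).comp (QuotientAddGroup.mk'_surjective _)
  have hkill : ∀ x : ModN (mordellWeilModTorsion W) n, (n : ℤ) • x = 0 := fun x ↦ by
    rw [natCast_zsmul, ← Nat.cast_smul_eq_nsmul (ZMod n), ZMod.natCast_self, zero_smul]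
  have hle : (zsmulAddGroupHom (n : ℤ) : W.toAffine.Point →+ W.toAffine.Point).range ≤ φ.ker := by
    rintro _ ⟨m, rfl⟩
    rw [AddMonoidHom.mem_ker, zsmulAddGroupHom_apply, map_zsmul, hkill]
  calc n ^ W.mordellWeilRank = Nat.card (ModN (mordellWeilModTorsion W) n) := by
        rw [ModN.natCard_eq, hrank]
    _ = Nat.card φ.range := by rw [AddMonoidHom.range_eq_top.mpr hφ, AddSubgroup.card_top]
    _ = φ.ker.index := (AddSubgroup.index_ker φ).symm
    _ ≤ _ := Nat.le_of_dvd (Nat.pos_of_ne_zero hidx) (AddSubgroup.index_dvd_of_le hle)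


omit [NumberField K] [W'.IsElliptic] [W.IsElliptic] [Fact p.Prime] in
/-- If `E(K)` is finite it is its own torsion subgroup: `#E(K) = #E(K)_{tors}`
(`WeierstrassCurve.torsionOrder`). Silverman, *AEC*, VIII.§6. [folklore] -/
theorem natCard_point_eq_torsionOrder [Finite W.toAffine.Point] :
    Nat.card W.toAffine.Point = W.torsionOrder := by
  rw [torsionOrder, AddCommGroup.torsion_eq_top_iff.mpr is_add_torsion_of_finite,
    AddSubgroup.card_top]

/-- **The shape met in practice (Cremona–Mazur 2000, Table 1; Agashe–Stein 2002 §4): `E(K)` finite of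
order prime to `p`, `E'(K_v)[p] = 0` at the places of `S`, and `rank E'(K) ≥ [K:ℚ] + 1`** (over
`ℚ`: rank `E'(ℚ) ≥ 2`). Then `[E(K):pE(K)] = 1`, `∏_{v∈S} #𝓛_v(E') = p^{[K:ℚ]}` and
`[E'(K):pE'(K)] ≥ p^{rank E'(K)} > p^{[K:ℚ]}`, so `exists_sha_ne_zero_of_congr` applies:
`Ш(E/K)[p] ≠ 0`. This is the situation of Cremona–Mazur's Table 1 (a rank-`0` optimal curve with
`#Ш_an = p²` and a `p`-congruent rank-`2` curve), with NO condition on the reduction at `p`.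
[cite: CremonaMazur2000, §3 and Table 1] [cite: AgasheStein2002, Thm. 3.1] -/
theorem exists_sha_ne_zero_of_congr_of_rank (hp2 : p ≠ 2)
    (θ : geomTorsion W' (p : ℤ) ≃+ geomTorsion W (p : ℤ))
    (hθ : ∀ (σ : absoluteGaloisGroup K) (P : geomTorsion W' (p : ℤ)), θ (σ • P) = σ • θ P)
    (S : Finset (HeightOneSpectrum (𝓞 K)))
    (hS : ∀ v : HeightOneSpectrum (𝓞 K), v ∉ S →
      W.HasGoodReductionAt v ∧ W'.HasGoodReductionAt v ∧ (p : 𝓞 K) ∉ v.asIdeal)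
    (hfin : Finite W.toAffine.Point) (hcop : (Nat.card W.toAffine.Point).Coprime p)
    (hrank : Module.finrank ℚ K + 1 ≤ W'.mordellWeilRank)
    (hloc : ∀ v ∈ S, Nat.card (nsmulAddMonoidHom p :
      (W'.baseChange (v.adicCompletion K)).toAffine.Point →+ _).ker = 1) :
    ∃ c : W.sha, c ≠ 0 ∧ p • c = 0 := by
  have hp : p.Prime := Fact.out
  refine exists_sha_ne_zero_of_congr W W' hp2 θ hθ S hS ?_
  rw [index_range_zsmul_eq_one_of_coprime hcop, one_mul, Finset.prod_eq_one hloc, one_mul]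
  calc p ^ Module.finrank ℚ K < p ^ (Module.finrank ℚ K + 1) :=
        Nat.pow_lt_pow_right hp.one_lt (Nat.lt_succ_self _)
    _ ≤ p ^ W'.mordellWeilRank := Nat.pow_le_pow_right hp.pos hrank
    _ ≤ _ := pow_mordellWeilRank_le_index_range_zsmul W' hp.ne_zero

end Main

end WeierstrassCurve

end
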